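import Mathlib.NumberTheory.GaussSum
import Mathlib.NumberTheory.DirichletCharacter.Basic
import Summits.BirchSwinnertonDyer.BirchSwinnertonDyer.Theorems.ResidualThetaTransportAtTwoDefs
import Summits.BirchSwinnertonDyer.BirchSwinnertonDyer.Theses.ResidualThetaTransportAtTwo
import Literature.NumberTheory.EllipticCurves.CMNewformGamma0LevelSquarefull

/-!
# Sketch — stub-ideation k4 (gen 28) for `stub_cmLambdaLower` of crux `ResidualThetaCountLowerPureAtTwo`
# (stmt-BirchSwinnertonDyer-26074; line `bt26_lambda` v7; the stub is RSL_g stmt-22608 VERBATIM)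

TECHNIQUE «assume the opposite» run on the NEW EVENT p726418 (2026-08-29T14:43:52Z ACCEPTED):
`Literature.NumberTheory.EllipticCurves.Kato2004.exists_zetaElement_newform_tatePairing_values_two`
(Kato 2004 Thm 12.5 (1) at `p = 2` for a weight-2 newform with `𝒪_λ`-coefficients, read on the pinned
ρ-layer Tate pairings) — the typed PRINT text behind child A `stub_kzgChildA` of onepair v3g.

A counterexample to `stub_cmLambdaLower` must now falsify a print node or the child-A PORT dictionary.
This file holds the KERNEL part of the audit (0 `sorry`):

* §A  dual-basis contraction identities over `(φ, t₀, b, b')` — the algebra that makes the port's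
      level exponent `t_N` cancel (`w_{N,j} := 2^{-s-t_N} Σ_k t₀(φ_{N,k} b'_j) • e_N(u_{N,k})`);
      instantiated on `π : OnePairPins …` (fields `t₀, ht₀, bO, bO', hbO`).
* §B  small levels: no even primitive Dirichlet character mod 4 (level `N = 2` of (VAL)/(VALρ) is
      vacuous — that level carries (TRIV)/(TRIVρ) only); mod 8 an even primitive character has
      `χ 5 = -1`, `χ 3 = -1` and is unique (level `N = 3` of (VAL) is ONE identity).
* §C  realisation covariance of the (VAL) clause: replacing `s₂` by `s₂ ∘ σ_c` multiplies the twisted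
      sum by `χ c` and the Gauss sum by `χ⁻¹ c` — the fact's `∀ (R, s₁, s₂)` is self-consistent.
* §D  localisation of a counterexample through the item-level certificate shape of p725355.

Nothing here proves BSD for any curve, closes or claims an item, or touches a registered text.
-/

-- a Cruxes sketch: orphan declarations by design
set_option linter.dupNamespace false

noncomputable section

open scoped Classical

namespace Summit.BirchSwinnertonDyer.BirchSwinnertonDyer.Cruxes.ResidualThetaCountLowerPureAtTwo.SideaK4G28

/-! ## §A Dual-basis contraction (port dictionary of child A from p726418) -/

section DualBasis

variable {R A : Type*} [CommRing R] [CommRing A] (φ : R →+* A) (t₀ : A →+ R)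
  (ht₀ : ∀ (c : R) (a : A), t₀ (φ c * a) = c * t₀ a) {ι : Type*} [Fintype ι] (b b' : ι → A)
  (hb : ∀ a : A, a = ∑ i, φ (t₀ (a * b' i)) * b i)
include ht₀ hb

/-- (C1) `Σ_i t₀(x bᵢ) t₀(y b'ᵢ) = t₀(x y)`: the `t₀`-pairing contracts along the dual families.
[cite: Kato2004Asterisque, §14.9 (p. 239)] -/
theorem dualBasis_contraction (x y : A) : ∑ i, t₀ (x * b i) * t₀ (y * b' i) = t₀ (x * y) := by
  conv_rhs => rw [hb y, Finset.mul_sum, map_sum]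
  refine Finset.sum_congr rfl fun i _ => ?_
  rw [mul_left_comm, ht₀]
  exact mul_comm _ _

/-- (C2) the same identity pushed through `φ`. [cite: Kato2004Asterisque, §14.9 (p. 239)] -/
theorem dualBasis_contraction_map (x y : A) :
    ∑ i, φ (t₀ (x * b i)) * φ (t₀ (y * b' i)) = φ (t₀ (x * y)) := by
  rw [← dualBasis_contraction φ t₀ ht₀ b b' hb x y, map_sum]
  simp_rw [map_mul]

variable {V : Type*} [AddCommGroup V] [Module A V]

/-- (C3) (BKρ side of the port) with weights `w_j := Σ_k φ(t₀(φₖ b'_j)) • E_k` one has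
`Σ_j φ(t₀(x b_j)) • w_j = Σ_k φ(t₀(x φₖ)) • E_k` — the level-dependent integralising exponent hidden in
`φₖ = 2^{t_N} ι f_{N,k}` never separates from `E_k`. [cite: Kato2004Asterisque, Thm. 12.5 (1) (pp. 221–222)] -/
theorem coeff_sum_weights_eq {K : Type*} [Fintype K] (E : K → V) (φk : K → A) (x : A) :
    ∑ j, φ (t₀ (x * b j)) • (∑ k, φ (t₀ (φk k * b' j)) • E k) = ∑ k, φ (t₀ (x * φk k)) • E k := by
  simp_rw [Finset.smul_sum, smul_smul]
  rw [Finset.sum_comm]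
  refine Finset.sum_congr rfl fun k _ => ?_
  rw [← Finset.sum_smul, dualBasis_contraction_map φ t₀ ht₀ b b' hb]

omit ht₀ in
/-- (C4) (VALρ/TRIVρ side of the port) `Σ_j b_j • w_j = Σ_k φₖ • E_k` for the same weights.
[cite: Kato2004Asterisque, Thm. 12.5 (1) (pp. 221–222)] -/
theorem basis_sum_weights_eq {K : Type*} [Fintype K] (E : K → V) (φk : K → A) :
    ∑ j, b j • (∑ k, φ (t₀ (φk k * b' j)) • E k) = ∑ k, φk k • E k := by
  simp_rw [Finset.smul_sum, smul_smul]
  rw [Finset.sum_comm]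
  refine Finset.sum_congr rfl fun k _ => ?_
  rw [← Finset.sum_smul]
  congr 1
  conv_rhs => rw [hb (φk k)]
  exact Finset.sum_congr rfl fun i _ => mul_comm _ _

end DualBasis

/-! ### §A′ Instantiation on the one-pair pin bundle (fields `t₀, ht₀, bO, bO', hbO` of `OnePairPins`) -/

section Pins

open Field NumberField IsDedekindDomain
  Literature.NumberTheory.EllipticCurves Literature.NumberTheory.GaloisRepresentations
  Literature.NumberTheory.EllipticCurves.GreenbergSelmer Literature.NumberTheory.EllipticCurves.Kobayashi2003
  Rat.HeightOneSpectrum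
  Summit.BirchSwinnertonDyer.BirchSwinnertonDyer.Theorems.OnePair

variable {S : Set (PadicAlgCl 2)} {W : WeierstrassCurve ℚ} [W.IsElliptic] {κ : ZpExtension ℚ 2} {γ : absoluteGaloisGroup ℚ}
  {S₀ : Finset (HeightOneSpectrum (𝓞 ℚ))} {n : ℕ} {ρ : FramedGaloisRep ℚ ↥(padicCoeffIntegers S) 2}
  {Θ : ∀ v : HeightOneSpectrum (𝓞 ℚ), ((2 : ℕ) : 𝓞 ℚ) ∈ v.asIdeal → (Cofree ρ ↥(padicCoeffField S) ≃+ (Fin n → ↥(W.geomPrimaryTorsion 2)))}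
  {hΘ : ∀ v hv (δ : absoluteGaloisGroup (v.adicCompletion ℚ)) m i,
    Θ v hv (resGalOfEmb (closureEmb (K := ℚ) (v.adicCompletion ℚ)) δ • m) i = resGalOfEmb (closureEmb (K := ℚ) (v.adicCompletion ℚ)) δ • Θ v hv m i}
  {I : Kato2004.IwasawaH1DataCoeff (FramedGaloisRep.toGaloisRep ρ) 2 κ γ}
  {Sg : AddSubgroup (subgroupH1 κ.kerSubgroup (Cofree ρ ↥(padicCoeffField S)))} [Module ↥(padicCoeffIntegers S) ↥Sg]
  (π : OnePairPins S W κ γ S₀ n ρ Θ hΘ I Sg)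

/-- (C1) at the pins: `Σ_i t₀(x bO_i) t₀(y bO'_i) = t₀(x y)`. [cite: Kato2004Asterisque, §14.9 (p. 239)] -/
theorem pins_dualBasis_contraction (x y : ↥(padicCoeffIntegers S)) :
    ∑ i, π.t₀ (x * π.bO i) * π.t₀ (y * π.bO' i) = π.t₀ (x * y) :=
  dualBasis_contraction (padicIntToCoeffIntegers S) π.t₀ π.ht₀ π.bO π.bO' π.hbO x y

/-- (C3) at the pins, values in any `𝒪`-module `V` (the port takes `V := ℚ̄₂`): the BK-coordinate side of the child-A port.
[cite: Kato2004Asterisque, Thm. 12.5 (1) (pp. 221–222)] -/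
theorem pins_coeff_sum_weights_eq {V : Type*} [AddCommGroup V] [Module ↥(padicCoeffIntegers S) V] {K : Type*} [Fintype K]
    (E : K → V) (φk : K → ↥(padicCoeffIntegers S)) (x : ↥(padicCoeffIntegers S)) :
    ∑ j, padicIntToCoeffIntegers S (π.t₀ (x * π.bO j)) • (∑ k, padicIntToCoeffIntegers S (π.t₀ (φk k * π.bO' j)) • E k) =
      ∑ k, padicIntToCoeffIntegers S (π.t₀ (x * φk k)) • E k :=
  coeff_sum_weights_eq (padicIntToCoeffIntegers S) π.t₀ π.ht₀ π.bO π.bO' π.hbO E φk x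

/-- (C4) at the pins: the value side of the child-A port. [cite: Kato2004Asterisque, Thm. 12.5 (1) (pp. 221–222)] -/
theorem pins_basis_sum_weights_eq {V : Type*} [AddCommGroup V] [Module ↥(padicCoeffIntegers S) V] {K : Type*} [Fintype K]
    (E : K → V) (φk : K → ↥(padicCoeffIntegers S)) :
    ∑ j, π.bO j • (∑ k, padicIntToCoeffIntegers S (π.t₀ (φk k * π.bO' j)) • E k) = ∑ k, φk k • E k :=
  basis_sum_weights_eq (padicIntToCoeffIntegers S) π.t₀ π.bO π.bO' π.hbO E φk

end Pins

/-! ## §B Small levels of the (VAL)/(VALρ) clause: conductor 4 is empty, conductor 8 is one character -/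

section SmallLevels

variable {R : Type*} [CommRing R]

theorem units_zmod_four (a : (ZMod 4)ˣ) : (a : ZMod 4) = 1 ∨ (a : ZMod 4) = -1 := by
  revert a; decide

/-- An even Dirichlet character mod 4 is trivial. -/
theorem dirichlet_four_eq_one_of_even (χ : DirichletCharacter R 4) (hχ : χ (-1) = 1) : χ = 1 := by
  refine MulChar.ext fun a => ?_
  rw [MulChar.one_apply_coe]
  rcases units_zmod_four a with h | h
  · rw [h, map_one]
  · rw [h, hχ]

/-- **Level `N = 2` is vacuous:** there is no even primitive Dirichlet character of level 4, so the (VAL) clause of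
p726418 and the (VALρ) clause of `KatoValCoord` say nothing at `N = 2` (`m = 0`); that level is governed by (TRIV)/(TRIVρ).
[cite: Kato2004Asterisque, Thm. 12.5 (1) (pp. 221–222)] -/
theorem not_isPrimitive_of_even_four (χ : DirichletCharacter R 4) (hχ : χ (-1) = 1) : ¬ χ.IsPrimitive := by
  rw [dirichlet_four_eq_one_of_even χ hχ, DirichletCharacter.isPrimitive_def, DirichletCharacter.conductor_one]
  decide

theorem units_zmod_eight (a : (ZMod 8)ˣ) :
    (a : ZMod 8) = 1 ∨ (a : ZMod 8) = -1 ∨ (a : ZMod 8) = 5 ∨ (a : ZMod 8) = -1 * 5 := by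
  revert a; decide

/-- An even character mod 8 with `χ 5 = 1` is trivial. -/
theorem dirichlet_eight_eq_one_of_even_of_five (χ : DirichletCharacter R 8) (hχ : χ (-1) = 1) (h5 : χ 5 = 1) :
    χ = 1 := by
  refine MulChar.ext fun a => ?_
  rw [MulChar.one_apply_coe]
  rcases units_zmod_eight a with h | h | h | h
  · rw [h, map_one]
  · rw [h, hχ]
  · rw [h, h5]
  · rw [h, map_mul, hχ, h5, one_mul]

/-- An even primitive character mod 8 has `χ 5 ≠ 1`. -/
theorem five_ne_one_of_even_isPrimitive_eight (χ : DirichletCharacter R 8) (hχ : χ (-1) = 1)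
    (hprim : χ.IsPrimitive) : χ 5 ≠ 1 := by
  intro h5
  have h := hprim
  rw [DirichletCharacter.isPrimitive_def, dirichlet_eight_eq_one_of_even_of_five χ hχ h5,
    DirichletCharacter.conductor_one] at h
  omega

/-- **Level `N = 3` is one character:** over a domain an even primitive character mod 8 takes the values
`χ 5 = -1`, `χ 3 = -1` (it is `χ₈`), so (VAL) at `N = 3` (`m = 1` of (VALρ)) is ONE identity — the cheapest
numerical cross-check site of the Birch side `r · Σ_a χ₈(a) [a/8]⁺_g`. [cite: MazurTateTeitelbaum1986, §I.8 (8.6)] -/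
theorem values_of_even_isPrimitive_eight [IsDomain R] (χ : DirichletCharacter R 8) (hχ : χ (-1) = 1)
    (hprim : χ.IsPrimitive) : χ 5 = -1 ∧ χ 3 = -1 := by
  have h5 : χ 5 = -1 := by
    have hsq : χ 5 * χ 5 = 1 := by
      rw [← map_mul]
      exact (congrArg χ (by decide : (5 : ZMod 8) * 5 = 1)).trans (map_one χ)
    rcases mul_self_eq_one_iff.mp hsq with h | h
    · exact absurd h (five_ne_one_of_even_isPrimitive_eight χ hχ hprim)
    · exact h
  refine ⟨h5, ?_⟩
  rw [show (3 : ZMod 8) = -1 * 5 by decide, map_mul, hχ, h5, one_mul]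

/-- Uniqueness of the even primitive character mod 8 over a domain. -/
theorem even_isPrimitive_eight_unique [IsDomain R] (χ χ' : DirichletCharacter R 8) (hχ : χ (-1) = 1)
    (hχ' : χ' (-1) = 1) (hp : χ.IsPrimitive) (hp' : χ'.IsPrimitive) : χ = χ' := by
  obtain ⟨h5, _⟩ := values_of_even_isPrimitive_eight χ hχ hp
  obtain ⟨h5', _⟩ := values_of_even_isPrimitive_eight χ' hχ' hp'
  refine MulChar.ext fun a => ?_
  rcases units_zmod_eight a with h | h | h | h
  · rw [h, map_one, map_one]
  · rw [h, hχ, hχ']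
  · rw [h, h5, h5']
  · rw [h, map_mul, map_mul, hχ, hχ', h5, h5']

/-- The `m = 0` instance of the character range of `KatoValCoord` (VALρ) / of (VAL) at `N = 2` is EMPTY: the binder
`(ψ : DirichletCharacter _ (2 ^ (0 + 2))), ψ (-1) = 1 → ψ.IsPrimitive → …` is never entered. -/
theorem valClause_level_zero_vacuous (ψ : DirichletCharacter R (2 ^ (0 + 2))) (hψ : ψ (-1) = 1) : ¬ ψ.IsPrimitive :=
  not_isPrimitive_of_even_four (R := R) ψ hψ

/-- The `m = 1` instance of the character range of `KatoValCoord` (VALρ) / of (VAL) at `N = 3` is ONE character with known values. -/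
theorem valClause_level_one_values [IsDomain R] (ψ : DirichletCharacter R (2 ^ (1 + 2))) (hψ : ψ (-1) = 1)
    (hprim : ψ.IsPrimitive) : ψ 5 = -1 ∧ ψ 3 = -1 :=
  values_of_even_isPrimitive_eight (R := R) ψ hψ hprim

end SmallLevels

/-! ## §C Realisation covariance of the (VAL) clause (`s₂ ↦ s₂ ∘ σ_c`) -/

section Realisation

variable {R R' : Type*} [CommRing R] [Fintype R] [DecidableEq R] [CommRing R']

/-- Twisting the test function by a unit, `F ↦ F(c ·)`, multiplies the `χ⁻¹`-twisted unit sum by `χ c`. -/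
theorem twistedSum_mulShift (χ : MulChar R R') (c : Rˣ) (F : R → R') :
    ∑ b : Rˣ, χ⁻¹ (b : R) * F (c * b) = χ c * ∑ b : Rˣ, χ⁻¹ (b : R) * F b := by
  have hc : χ (c : R) * χ⁻¹ (c : R) = 1 := by
    rw [← MulChar.mul_apply, mul_inv_cancel, MulChar.one_apply_coe]
  rw [Finset.mul_sum]
  refine Fintype.sum_bijective (fun b : Rˣ => c * b) (Group.mulLeft_bijective c) _ _ fun b => ?_
  simp only [Units.val_mul, map_mul]
  rw [← mul_assoc, ← mul_assoc, hc, one_mul]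

/-- **(VAL) is realisation-covariant.** In p726418's (VAL) clause, replacing the cyclotomic realisation `s₂` by
`s₂ ∘ σ_c` turns the inner sum `Σ_b χ⁻¹(b) s₂(σ_b u)` into `Σ_b χ⁻¹(b) F(c b)` and the additive character of the
Gauss sum into `ψ.mulShift c`; the product is unchanged, so the clause cannot be refuted by changing `s₂`.
[cite: Kato2004Asterisque, Thm. 12.5 (1) (pp. 221–222)] -/
theorem twistedSum_mul_gaussSum_mulShift (χ : MulChar R R') (ψ : AddChar R R') (c : Rˣ) (F : R → R') :
    (∑ b : Rˣ, χ⁻¹ (b : R) * F (c * b)) * gaussSum χ (ψ.mulShift c) =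
      (∑ b : Rˣ, χ⁻¹ (b : R) * F b) * gaussSum χ ψ := by
  rw [twistedSum_mulShift, mul_comm (χ (c : R)), mul_assoc, gaussSum_mulShift]

end Realisation

/-! ## §D Where a counterexample to the stub can live after p725355 / p726418 -/

section Localisation

open Summit.BirchSwinnertonDyer.BirchSwinnertonDyer.Theses.ResidualThetaTransportAtTwo
  Literature.NumberTheory.EllipticCurves.ModularForms

/-- Through the item-level certificate shape of p725355 (`residualSignedLambdaLowerCMAtTwo_of_prints`), a failure of
RSL_g (= `stub_cmLambdaLower`'s text) falsifies the KZ_g supply (item 24105: K0a ∧ K0b ∧ body) or LVsq — nothing in kernel.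
[cite: Kato2004Asterisque, Thm. 12.5 (1)–(2) (pp. 221–222)] -/
theorem counterexample_localisation
    (hcert : KatoZetaCMFormAtTwoSupply → cmNewform_gamma0_sq_dvd_level → ResidualSignedLambdaLowerCMAtTwo)
    (hneg : ¬ ResidualSignedLambdaLowerCMAtTwo) :
    ¬ KatoZetaCMFormAtTwoSupply ∨ ¬ cmNewform_gamma0_sq_dvd_level := by
  by_contra h
  simp only [not_or, not_not] at h
  exact hneg (hcert h.1 h.2)

/-- The line-level form: with the interior stations landed ((E) p722652, (DESC), (R) p725106, K0a p722694) and the glue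
`KZgGlue.katoZetaCMAtTwo_of_interior` (p719630), a failure of RSL_g falsifies child A (p726418 + its port), child B's body
(«Kato125b», to be typed) , K0b, or LVsq. Stated over the clause names as propositions. -/
theorem counterexample_localisation_line {A B K0b LV KZg RSL : Prop}
    (hglue : A → B → K0b → KZg) (hcert : KZg → LV → RSL) (hneg : ¬ RSL) :
    ¬ A ∨ ¬ B ∨ ¬ K0b ∨ ¬ LV := by
  by_contra h
  simp only [not_or, not_not] at h
  exact hneg (hcert (hglue h.1 h.2.1 h.2.2.1) h.2.2.2)

end Localisation

end Summit.BirchSwinnertonDyer.BirchSwinnertonDyer.Cruxes.ResidualThetaCountLowerPureAtTwo.SideaK4G28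

end
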